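import Summits.NavierStokesRegularity.NavierStokesRegularity.Theses.AngularGalerkinLadder
import Literature.Analysis.FluidPDE.RotatedDSSLimitStructure
import Literature.Analysis.FluidPDE.AncientMildOfClassical

/-!
# `StructurePasses` (route AngularGalerkinLadder, item stmt-NavierStokesRegularity-19855, rev 3) —
# candidate proof AS TYPED (refuter5 K-check; a prover lands it `--workitem stmt-NavierStokesRegularity-19855`)

Assembly of three tree theorems, no new analysis:
* `Literature.Analysis.FluidPDE.typeI_rotatedDSS_structure_of_tendsto` (lit g13, p476224): `1 < c'`,
  `IsRotatedDSS c' R' v`, Type-I, slice measurability and non-triviality of the limit from POINTWISE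
  slice convergence + joint continuity (Baire/Osgood passage of the rDSS identity — no time-equicontinuity);
* `Literature.Analysis.FluidPDE.IsClassicalNSSolutionOn.isAncientMildSolution_of_hasTypeIDecay`
  (`AncientMildOfClassical.lean`, lit g13 p479347: classical on the open past + Type-I + pressure bounded
  on every `Iic t` ⇒ ancient mild) — route-independent Literature home, replacing the earlier import of
  `Theorems/CorkscrewDynamoClassicalCorkscrewSuffices` (another route's cone; hygiene re-proof by
  ns-blowup-lean g11, statement unchanged).
-/

set_option linter.dupNamespace false

namespace Summit.NavierStokesRegularity.NavierStokesRegularity.Theorems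

open Filter Topology Set MeasureTheory
open Literature.Analysis.FluidPDE
open Summit.NavierStokesRegularity.FluidComputer

/-- item stmt-NavierStokesRegularity-19855 `StructurePasses` (rev 3), AS TYPED: every ladder limit of an
admissible window sequence is a non-trivial Type-I rotation-corrected backward-DSS ancient mild solution.
Assembly of `typeI_rotatedDSS_structure_of_tendsto` (p476224) with
`IsClassicalNSSolutionOn.isAncientMildSolution_of_hasTypeIDecay` (p479347). -/
theorem angularGalerkinLadder_structurePasses :
    Summit.NavierStokesRegularity.NavierStokesRegularity.Theses.AngularGalerkinLadder.StructurePasses := by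
  intro C₀ cmin cmax δ L ε c R u p d φ c' R' v q hw hlim
  obtain ⟨hcmin, hδ, -, hwin⟩ := hw
  obtain ⟨-, hc, hR, hloc, hcl, hTI, hv0, hq⟩ := hlim
  -- hypotheses of the structure theorem, along the subsequence `φ`
  have hprof : ∀ n, AngularLadder.IsRungProfile (L (φ n)) C₀ (c (φ n)) (R (φ n)) (u (φ n))
      (p (φ n)) (d (φ n)) := fun n => (hwin (φ n)).isRungProfile
  have hcn : ∀ n, cmin ≤ c (φ n) := fun n => (hwin (φ n)).2.1
  have hdss : ∀ n, IsRotatedDSS (c (φ n)) (R (φ n)) (u (φ n)) := fun n => (hprof n).isRotatedDSS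
  have hI : ∀ n, HasTypeIDecay C₀ (u (φ n)) := fun n => (hprof n).hasTypeIDecay
  have hcont : ∀ n, ContinuousOn (Function.uncurry (u (φ n))) (Iio 0 ×ˢ univ) := fun n =>
    (hprof n).classical.smooth_velocity.continuousOn
  have hamp : ∀ n, ∃ x, δ ≤ ‖u (φ n) (-1) x‖ := fun n => (hwin (φ n)).2.2.2.1
  have hvcont : ContinuousOn (Function.uncurry v) (Iio 0 ×ˢ univ) := hcl.smooth_velocity.continuousOn
  have hptw : ∀ t < 0, ∀ x, Tendsto (fun n => u (φ n) t x) atTop (𝓝 (v t x)) := fun t ht x =>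
    (hloc t ht).tendstoLocallyUniformlyOn.tendsto_at (Set.mem_univ x)
  have hloc1 : TendstoLocallyUniformly (fun n => u (φ n) (-1)) (v (-1)) atTop := hloc (-1) (by norm_num)
  obtain ⟨hc', hDSS, hTI', hmeas, -, hnz⟩ :=
    typeI_rotatedDSS_structure_of_tendsto (μ := (volume : Measure (EuclideanSpace ℝ (Fin 3))))
      hcmin hδ hcn hc hR hdss hI hcont hamp hvcont hv0 hptw hloc1
  -- ancient mildness from the classical system + Type-I + the pressure clause
  have hmild : IsAncientMildSolution 1 v := hcl.isAncientMildSolution_of_hasTypeIDecay one_pos hTI hq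
  exact ⟨hc', hmild, hmeas, hDSS, ⟨C₀, hTI⟩, hnz⟩

end Summit.NavierStokesRegularity.NavierStokesRegularity.Theorems
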